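/-
Copyright (c) 2026 the pub-hodgecm-mathlib formalisation cell (harness21).  Prover seat hodgecm-mathlib-A-p12 (g35): P6b wave A seat 1 «FFGS-QUOT» (A), §A
«THE GALOIS TWIST ∕ CHARACTERISTIC POLYNOMIALS UNDER BASE CHANGE» (dealer desk F0P6b-plan (g13) DEAL P6b-A1, director g34 s1734; box F0P6-ref1 (g8)), 2026-09-03.
-/
import Mathlib.RingTheory.HopfAlgebra.Convolution
import Mathlib.RingTheory.TensorProduct.Free
import Mathlib.RingTheory.TensorProduct.Finite
import Mathlib.LinearAlgebra.Charpoly.ToMatrix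
import HarnessLib

/-!
# Quotient of an affine scheme by a finite locally free group scheme, §A: the Galois twist of `D ⊗ H` and base change of characteristic polynomials

Topic `AlgebraicGeometry/GroupSchemes`; namespace `Literature.AlgebraicGeometry.GroupSchemes.FiniteFlatQuotientAffine` (the sub-namespace names
the object: the affine quotient `X ⧸ Z = Spec C₀` of [MumfordAV1970] §12 Thm. 1 ∕ [SGA3I] Exp. V Thm. 4.1 ∕ [StacksProject] Tag 03BM); THEOREMS ONLY (no
definition, instance, notation or named fact); Mathlib-footed.  Cell `pub/hodgecm-mathlib` (D-0151), organ «FFGS-QUOT» (A) of the P6b fan-out sheet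
(desk F0P6b-plan (g13) `SOCKETS-P6b.fanout.v1` §0, signature sheet `WAVEA-SIGNATURES.v2`), lane `--supports stmt-HodgeConjecture-24832`; count-neutral
(banked Row-4B capital).  HC_CM is proved only modulo the printed citations (2 remaining named inputs hLiu418 = `stmt-HodgeConjecture-24832`, h413 =
`stmt-HodgeConjecture-24833`) until rung 0 closes.

CONTENT — two generic tools used by every later § of the organ (`…QuotientAffineIntegral` §B, the basis criterion §C, the local step §D, the assembly §E):
* **§A.1 THE GALOIS TWIST.**  `H` a COMMUTATIVE Hopf algebra over the commutative ring `R` (Mathlib `HopfAlgebra R H`, `Spec H = Z`), `D` a commutative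
  `R`-algebra, `j : H →ₐ[R] D` an algebra map (a `D`-point of `Z`).  The `D`-algebra endomorphism
  `T_j := productMap includeLeft ((j ⊗ id) ∘ Δ) : D ⊗[R] H → D ⊗[R] H`, `d ⊗ h ↦ (d ⊗ 1)·(j ⊗ id)(Δ h)` — the ring map of the shear `(x, g) ↦ (x·g…)`, i.e. the
  base change along `j` of the Galois isomorphism `H ⊗ H ⥲ H ⊗ H`, `a ⊗ b ↦ (a ⊗ 1)Δ b` — is BIJECTIVE (`galoisTwist_bijective`), with inverse
  `productMap includeLeft ((j∘S ⊗ id) ∘ Δ)`, and `D`-linear (`galoisTwist_smul`).  The proof is group theory in Mathlib's convolution monoid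
  `WithConv (H →ₐ[R] D ⊗ H)` of points (`AlgHom.comp_convMul_distrib`, `AlgHom.antipode_id_cancel`): with `u := includeLeft ∘ j`, `v := includeRight`,
  the `H`-leg of `T_j` is `u * v` (`map_comp_comulAlgHom_eq_convMul`) and `T ∘ ((u∘S) * v) = (u∘S) * (u * v) = v`.  (Mathlib's `AlgHom.convGroup` instance is
  not used: it asks for a bialgebra structure on the TARGET; the two inverse laws are re-derived as `toConv_comp_antipode_mul_toConv` ∕
  `toConv_mul_toConv_comp_antipode`.)
* **§A.2 CHARACTERISTIC POLYNOMIALS UNDER BASE CHANGE.**  For `H` finite free over `R` with basis `b`, an `R`-algebra map `f : A → A'` and `x : A ⊗[R] H`: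
  the matrix of left multiplication by `(f ⊗ id) x` in the basis `1 ⊗ bᵢ` is `f` applied entrywise to that of `x` (`leftMulMatrix_map`), hence
  `(charpoly (lmul x)).map f = charpoly (lmul ((f ⊗ id) x))` (`charpoly_lmul_map`; Mathlib `LinearMap.charpoly_toMatrix`, `Matrix.charpoly_map`) — the
  basis-free form of «the norm is compatible with base change» in [StacksProject] Tag 03BH.

## References
* [MumfordAV1970] D. Mumford, *Abelian Varieties* (1970), §12 «Quotients by finite group schemes», Thm. 1 and its proof pp. 111–115.
* [SGA3I] M. Demazure, A. Grothendieck (eds.), *SGA 3, Tome I*, Exp. V, Thm. 4.1 (quotient by a finite locally free groupoid, affine case).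
* [StacksProject] The Stacks Project, Tags 03BH (the norm lands in the invariants), 03BI (`t ≅ s` via the inverse), 03BJ, 03BM (finite flat groupoids,
  affine case).
* [Waterhouse1979] W. C. Waterhouse, *Introduction to Affine Group Schemes*, GTM 66 (1979), §1.4 (Hopf algebras; the antipode is the inverse in `Hom(A, R)`).
-/

set_option autoImplicit false

namespace Literature.AlgebraicGeometry.GroupSchemes.FiniteFlatQuotientAffine

open TensorProduct Algebra.TensorProduct WithConv

section Twist

variable {R : Type*} [CommRing R] {H : Type*} [CommRing H] [HopfAlgebra R H]
  {E : Type*} [CommRing E] [Algebra R E]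

/-! ## §A.1  The Galois twist `T_j` of `D ⊗[R] H` is bijective (group theory in the convolution monoid of points) -/

/-- In the convolution monoid `WithConv (H →ₐ[R] E)` of `E`-points of the group scheme `Spec H` (Mathlib), the point `h ∘ S` is a LEFT inverse of `h`:
`(h ∘ S) * h = 1` (the antipode axiom `S * id = ηε` pushed forward along `h`, Mathlib `AlgHom.antipode_id_cancel` + `AlgHom.comp_convMul_distrib`): the
antipode gives the inverse in the group `Z(E) = Hom(H, E)` ([Waterhouse1979] §1.4).  Stated because Mathlib's `AlgHom.convGroup` instance asks for a
(spurious) bialgebra structure on the target. [cite: Waterhouse1979, §1.4] -/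
theorem toConv_comp_antipode_mul_toConv (h : H →ₐ[R] E) :
    toConv (h.comp (HopfAlgebra.antipodeAlgHom R H)) * toConv h = 1 := by
  have h1 : toConv (h.comp (HopfAlgebra.antipodeAlgHom R H)) * toConv h =
      toConv (h.comp (toConv (HopfAlgebra.antipodeAlgHom R H) * toConv (AlgHom.id R H)).ofConv) := by
    rw [AlgHom.comp_convMul_distrib, ofConv_toConv, ofConv_toConv, toConv_ofConv, AlgHom.comp_id]
  have h2 : h.comp (Algebra.ofId R H) = Algebra.ofId R E := AlgHom.ext fun r => by simp
  rw [h1, AlgHom.antipode_id_cancel, AlgHom.convOne_def, ofConv_toConv, ← AlgHom.comp_assoc, h2,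
    ← AlgHom.convOne_def]

/-- In the convolution monoid `WithConv (H →ₐ[R] E)`, `h ∘ S` is a RIGHT inverse of `h`: `h * (h ∘ S) = 1` (from Mathlib `LinearMap.id_mul_antipode`;
[Waterhouse1979] §1.4: `S` is the inverse in `Hom(H, E)`). [cite: Waterhouse1979, §1.4] -/
theorem toConv_mul_toConv_comp_antipode (h : H →ₐ[R] E) :
    toConv h * toConv (h.comp (HopfAlgebra.antipodeAlgHom R H)) = 1 := by
  have h0 : toConv (AlgHom.id R H) * toConv (HopfAlgebra.antipodeAlgHom R H) = 1 := by
    apply WithConv.ofConv_injective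
    apply AlgHom.toLinearMap_injective
    apply WithConv.toConv_injective
    rw [AlgHom.toLinearMap_convMul, AlgHom.toLinearMap_convOne]
    simp [LinearMap.id_mul_antipode]
  have h1 : toConv h * toConv (h.comp (HopfAlgebra.antipodeAlgHom R H)) =
      toConv (h.comp (toConv (AlgHom.id R H) * toConv (HopfAlgebra.antipodeAlgHom R H)).ofConv) := by
    rw [AlgHom.comp_convMul_distrib, ofConv_toConv, ofConv_toConv, toConv_ofConv, AlgHom.comp_id]
  have h2 : h.comp (Algebra.ofId R H) = Algebra.ofId R E := AlgHom.ext fun r => by simp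
  rw [h1, h0, AlgHom.convOne_def, ofConv_toConv, ← AlgHom.comp_assoc, h2, ← AlgHom.convOne_def]

variable {D : Type*} [CommRing D] [Algebra R D] (j : H →ₐ[R] D)

/-- The `H`-leg of the Galois twist, `h ↦ (j ⊗ id)(Δ h) : H → D ⊗[R] H`, is the convolution product `u * v` of the points `u := includeLeft ∘ j` and
`v := includeRight` of `Spec H` with values in `D ⊗[R] H` (the group law of `Z(D ⊗ H) = Hom(H, D ⊗ H)` is dual to `Δ`, [Waterhouse1979] §1.4).
[cite: Waterhouse1979, §1.4] -/
theorem map_comp_comulAlgHom_eq_convMul :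
    (Algebra.TensorProduct.map j (AlgHom.id R H)).comp (Bialgebra.comulAlgHom R H) =
      (toConv ((includeLeft : D →ₐ[R] D ⊗[R] H).comp j) *
        toConv (includeRight : H →ₐ[R] D ⊗[R] H)).ofConv := by
  have hmaps : Algebra.TensorProduct.map j (AlgHom.id R H) =
      Algebra.TensorProduct.lift ((includeLeft : D →ₐ[R] D ⊗[R] H).comp j)
        (includeRight : H →ₐ[R] D ⊗[R] H) (fun _ _ => .all _ _) :=
    Algebra.TensorProduct.ext' fun a b => by simp [Algebra.TensorProduct.tmul_mul_tmul]
  ext h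
  rw [AlgHom.comp_apply, Bialgebra.comulAlgHom_apply, AlgHom.convMul_apply, ofConv_toConv,
    ofConv_toConv, hmaps]

/-- **The Galois twist has a right inverse.**  `T_j := productMap includeLeft ((j ⊗ id) ∘ Δ)` (`d ⊗ h ↦ (d ⊗ 1)·(j ⊗ id)(Δ h)`, the ring map of
`(x, g) ↦ (x·g, g)`-type shears of `Spec D × Z`) composed with `T'_j := productMap includeLeft ((u ∘ S) * v)` is the identity: on the `H`-leg
`T ∘ ((u∘S) * v) = (T ∘ u ∘ S) * (T ∘ v) = (u ∘ S) * (u * v) = v`. [cite: StacksProject, Tag 03BI] -/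
theorem galoisTwist_comp_galoisTwistInv :
    (productMap (includeLeft : D →ₐ[R] D ⊗[R] H)
        ((Algebra.TensorProduct.map j (AlgHom.id R H)).comp (Bialgebra.comulAlgHom R H))).comp
      (productMap (includeLeft : D →ₐ[R] D ⊗[R] H)
        (toConv (((includeLeft : D →ₐ[R] D ⊗[R] H).comp j).comp (HopfAlgebra.antipodeAlgHom R H)) *
          toConv (includeRight : H →ₐ[R] D ⊗[R] H)).ofConv) = AlgHom.id R (D ⊗[R] H) := by
  set u : WithConv (H →ₐ[R] D ⊗[R] H) := toConv ((includeLeft : D →ₐ[R] D ⊗[R] H).comp j) with hu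
  set u' : WithConv (H →ₐ[R] D ⊗[R] H) :=
    toConv (((includeLeft : D →ₐ[R] D ⊗[R] H).comp j).comp (HopfAlgebra.antipodeAlgHom R H)) with hu'
  set v : WithConv (H →ₐ[R] D ⊗[R] H) := toConv (includeRight : H →ₐ[R] D ⊗[R] H) with hv
  set T := productMap (includeLeft : D →ₐ[R] D ⊗[R] H)
        ((Algebra.TensorProduct.map j (AlgHom.id R H)).comp (Bialgebra.comulAlgHom R H)) with hT
  have hT' : T = productMap (includeLeft : D →ₐ[R] D ⊗[R] H) (u * v).ofConv := by
    rw [hT, map_comp_comulAlgHom_eq_convMul]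
  have hTu : T.comp u'.ofConv = u'.ofConv := by
    rw [hu', ofConv_toConv, ← AlgHom.comp_assoc, ← AlgHom.comp_assoc, hT, productMap_left]
  have hTv : T.comp v.ofConv = (u * v).ofConv := by
    rw [hT', hv, ofConv_toConv, productMap_right]
  have key : T.comp (u' * v).ofConv = v.ofConv := by
    rw [AlgHom.comp_convMul_distrib, hTu, hTv, toConv_ofConv, toConv_ofConv, ← mul_assoc, hu', hu,
      toConv_comp_antipode_mul_toConv, one_mul]
  refine Algebra.TensorProduct.ext' fun a b => ?_
  have e1 : T ((u' * v).ofConv b) = v.ofConv b := by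
    have := AlgHom.congr_fun key b; rwa [AlgHom.comp_apply] at this
  rw [AlgHom.comp_apply, AlgHom.id_apply, productMap_apply_tmul, map_mul, e1, hv, ofConv_toConv, hT,
    Algebra.TensorProduct.includeLeft_apply, productMap_left_apply, Algebra.TensorProduct.includeLeft_apply,
    Algebra.TensorProduct.includeRight_apply, Algebra.TensorProduct.tmul_mul_tmul, mul_one, one_mul]

/-- **The Galois twist has a left inverse** (same computation with the roles of `u` and `u ∘ S` exchanged: `T' ∘ (u * v) = u * ((u∘S) * v) = v`).
[cite: StacksProject, Tag 03BI] -/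
theorem galoisTwistInv_comp_galoisTwist :
    (productMap (includeLeft : D →ₐ[R] D ⊗[R] H)
        (toConv (((includeLeft : D →ₐ[R] D ⊗[R] H).comp j).comp (HopfAlgebra.antipodeAlgHom R H)) *
          toConv (includeRight : H →ₐ[R] D ⊗[R] H)).ofConv).comp
      (productMap (includeLeft : D →ₐ[R] D ⊗[R] H)
        ((Algebra.TensorProduct.map j (AlgHom.id R H)).comp (Bialgebra.comulAlgHom R H))) =
      AlgHom.id R (D ⊗[R] H) := by
  set u : WithConv (H →ₐ[R] D ⊗[R] H) := toConv ((includeLeft : D →ₐ[R] D ⊗[R] H).comp j) with hu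
  set u' : WithConv (H →ₐ[R] D ⊗[R] H) :=
    toConv (((includeLeft : D →ₐ[R] D ⊗[R] H).comp j).comp (HopfAlgebra.antipodeAlgHom R H)) with hu'
  set v : WithConv (H →ₐ[R] D ⊗[R] H) := toConv (includeRight : H →ₐ[R] D ⊗[R] H) with hv
  set T' := productMap (includeLeft : D →ₐ[R] D ⊗[R] H) (u' * v).ofConv with hT'
  have hTu : T'.comp u.ofConv = u.ofConv := by
    rw [hu, ofConv_toConv, ← AlgHom.comp_assoc, hT', productMap_left]
  have hTv : T'.comp v.ofConv = (u' * v).ofConv := by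
    rw [hT', hv, ofConv_toConv, productMap_right]
  have key : T'.comp (u * v).ofConv = v.ofConv := by
    rw [AlgHom.comp_convMul_distrib, hTu, hTv, toConv_ofConv, toConv_ofConv, ← mul_assoc, hu', hu,
      toConv_mul_toConv_comp_antipode, one_mul]
  set T := productMap (includeLeft : D →ₐ[R] D ⊗[R] H)
        ((Algebra.TensorProduct.map j (AlgHom.id R H)).comp (Bialgebra.comulAlgHom R H)) with hT
  have hT'' : T = productMap (includeLeft : D →ₐ[R] D ⊗[R] H) (u * v).ofConv := by
    rw [hT, map_comp_comulAlgHom_eq_convMul]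
  rw [hT'']
  refine Algebra.TensorProduct.ext' fun a b => ?_
  have e1 : T' ((u * v).ofConv b) = v.ofConv b := by
    have := AlgHom.congr_fun key b; rwa [AlgHom.comp_apply] at this
  rw [AlgHom.comp_apply, AlgHom.id_apply, productMap_apply_tmul, map_mul, e1, hv, ofConv_toConv, hT',
    Algebra.TensorProduct.includeLeft_apply, productMap_left_apply, Algebra.TensorProduct.includeLeft_apply,
    Algebra.TensorProduct.includeRight_apply, Algebra.TensorProduct.tmul_mul_tmul, mul_one, one_mul]

/-- **The Galois twist `T_j : D ⊗[R] H → D ⊗[R] H`, `d ⊗ h ↦ (d ⊗ 1)·(j ⊗ id)(Δ h)`, is bijective** for every algebra map `j : H → D` from a commutative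
Hopf algebra to a commutative algebra (it is the base change along `j` of the Galois isomorphism `H ⊗ H ⥲ H ⊗ H`, `a ⊗ b ↦ (a ⊗ 1)Δ b`, i.e. of the shear
`(g, g') ↦ (g g', g')` of `Z × Z`; «`t` is isomorphic to `s` by the inverse of the groupoid», [StacksProject] Tag 03BI). [cite: StacksProject, Tag 03BI] -/
theorem galoisTwist_bijective :
    Function.Bijective (productMap (includeLeft : D →ₐ[R] D ⊗[R] H)
        ((Algebra.TensorProduct.map j (AlgHom.id R H)).comp (Bialgebra.comulAlgHom R H))) := by
  set T := productMap (includeLeft : D →ₐ[R] D ⊗[R] H)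
        ((Algebra.TensorProduct.map j (AlgHom.id R H)).comp (Bialgebra.comulAlgHom R H)) with hT
  set T' := productMap (includeLeft : D →ₐ[R] D ⊗[R] H)
        (toConv (((includeLeft : D →ₐ[R] D ⊗[R] H).comp j).comp (HopfAlgebra.antipodeAlgHom R H)) *
          toConv (includeRight : H →ₐ[R] D ⊗[R] H)).ofConv with hT'
  have h1 : ∀ x, T (T' x) = x := fun x => by
    rw [← AlgHom.comp_apply, hT, hT', galoisTwist_comp_galoisTwistInv, AlgHom.id_apply]
  have h2 : ∀ x, T' (T x) = x := fun x => by
    rw [← AlgHom.comp_apply, hT, hT', galoisTwistInv_comp_galoisTwist, AlgHom.id_apply]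
  exact ⟨Function.LeftInverse.injective h2, Function.RightInverse.surjective h1⟩

/-- The Galois twist `T_j` is `D`-linear for the left `D`-module structure of `D ⊗[R] H` (it fixes `d ⊗ 1`: the shear of [StacksProject] Tag 03BI
commutes with the projection `s`). [cite: StacksProject, Tag 03BI] -/
theorem galoisTwist_smul (d : D) (x : D ⊗[R] H) :
    productMap (includeLeft : D →ₐ[R] D ⊗[R] H)
        ((Algebra.TensorProduct.map j (AlgHom.id R H)).comp (Bialgebra.comulAlgHom R H)) (d • x) =
      d • productMap (includeLeft : D →ₐ[R] D ⊗[R] H)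
        ((Algebra.TensorProduct.map j (AlgHom.id R H)).comp (Bialgebra.comulAlgHom R H)) x := by
  rw [Algebra.smul_def, Algebra.smul_def, map_mul, Algebra.TensorProduct.algebraMap_apply, Algebra.algebraMap_self,
    RingHom.id_apply, productMap_left_apply, Algebra.TensorProduct.includeLeft_apply]

end Twist

/-! ## §A.2  Naturality of the characteristic polynomial of a left multiplication on `A ⊗[R] H` -/

section Charpoly

variable {R : Type*} [CommRing R] {H : Type*} [CommRing H] [Algebra R H]
  {ι : Type*} [Fintype ι] [DecidableEq ι] (b : Module.Basis ι R H)
  {A A' : Type*} [CommRing A] [Algebra R A] [CommRing A'] [Algebra R A'] (f : A →ₐ[R] A')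

omit [Fintype ι] [DecidableEq ι] in
/-- Coordinates in the basis `1 ⊗ bᵢ` of `A ⊗[R] H` are natural in the algebra `A`: `repr ((f ⊗ id) y) i = f (repr y i)` (the base-change
compatibility underlying «the norm is compatible with base change», [StacksProject] Tag 03BH proof). [cite: StacksProject, Tag 03BH] -/
theorem basis_repr_map_apply (y : A ⊗[R] H) (i : ι) :
    (Algebra.TensorProduct.basis A' b).repr (Algebra.TensorProduct.map f (AlgHom.id R H) y) i =
      f ((Algebra.TensorProduct.basis A b).repr y i) := by
  induction y using TensorProduct.induction_on with
  | zero => simp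
  | tmul a h =>
      simp [Algebra.TensorProduct.basis_repr_tmul]
  | add x y hx hy => simp [map_add, hx, hy]

/-- The matrix of left multiplication by `(f ⊗ id) x` on `A' ⊗[R] H` (basis `1 ⊗ bᵢ`) is `f` applied entrywise to the matrix of left multiplication by
`x` on `A ⊗[R] H` («the norm ∕ characteristic polynomial is compatible with base change», [StacksProject] Tag 03BH proof). [cite: StacksProject, Tag 03BH] -/
theorem leftMulMatrix_map (x : A ⊗[R] H) :
    (Algebra.leftMulMatrix (Algebra.TensorProduct.basis A b) x).map f =
      Algebra.leftMulMatrix (Algebra.TensorProduct.basis A' b)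
        (Algebra.TensorProduct.map f (AlgHom.id R H) x) := by
  ext i k
  rw [Matrix.map_apply, Algebra.leftMulMatrix_eq_repr_mul, Algebra.leftMulMatrix_eq_repr_mul,
    Algebra.TensorProduct.basis_apply, Algebra.TensorProduct.basis_apply, ← basis_repr_map_apply b f]
  congr 2
  rw [map_mul, Algebra.TensorProduct.map_tmul, map_one, AlgHom.id_apply]

end Charpoly

section CharpolyFree

variable {R : Type*} [CommRing R] {H : Type*} [CommRing H] [Algebra R H] [Module.Free R H] [Module.Finite R H]
  {A A' : Type*} [CommRing A] [Algebra R A] [CommRing A'] [Algebra R A'] (f : A →ₐ[R] A')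

/-- **Base change of the characteristic polynomial of a left multiplication**: for `H` finite free over `R`, an `R`-algebra map `f : A → A'` and
`x : A ⊗[R] H`, `(charpoly (lmul x)).map f = charpoly (lmul ((f ⊗ id) x))` (both over the free modules `A ⊗ H ∕ A`, `A' ⊗ H ∕ A'`; Mathlib
`LinearMap.charpoly_toMatrix`, `Matrix.charpoly_map`). [cite: StacksProject, Tag 03BH] -/
theorem charpoly_lmul_map (x : A ⊗[R] H) :
    ((Algebra.lmul A (A ⊗[R] H) x).charpoly).map (f : A →+* A') =
      (Algebra.lmul A' (A' ⊗[R] H) (Algebra.TensorProduct.map f (AlgHom.id R H) x)).charpoly := by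
  classical
  let b := Module.Free.chooseBasis R H
  rw [← LinearMap.charpoly_toMatrix _ (Algebra.TensorProduct.basis A b),
    ← LinearMap.charpoly_toMatrix _ (Algebra.TensorProduct.basis A' b), ← Algebra.leftMulMatrix_apply,
    ← Algebra.leftMulMatrix_apply, ← Matrix.charpoly_map]
  congr 1
  exact leftMulMatrix_map b f x

end CharpolyFree

end Literature.AlgebraicGeometry.GroupSchemes.FiniteFlatQuotientAffine
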